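import Summits.FinalStateConjecture.FinalStateConjecture.Theorems.BartnikGapSettlingBondiBartnikRigidityMarchingLemmaChartGlue
import HarnessLib

/-!
# K2b-5 `stub_marchingLemma`, brick 11b: gluing two exact charts, with the off-domain clause — line
# `direct-method-on-the-cone` (crux `BondiBartnikRigidity`, stmt-FinalStateConjecture-10807)

`ChartGlue.glue'`: the gluing lemma `ChartGlue.glue` with one more (definitional) conclusion, that the
glued chart coincides with the second chart off `pullK Q₁`; the marching step needs it to carry the
boundary clause `Ψ = Ψ_E on pullK (F ∪ slab ∪ (O ∩ roofK))` of the invariant across the gluing (the slab and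
roof points are outside both chart domains).  Same proof.

References: Dafermos–Rodnianski arXiv:0811.0354, §5.1 [DafermosRodnianski2008].  No definitions, no named facts.
-/

noncomputable section

-- D-0017: single-problem summit, `Summit.<S>.<S>.…` by design (cf. lakefile `weak.linter.dupNamespace`).
set_option linter.dupNamespace false
set_option maxSynthPendingDepth 3

open Set Filter Function Topology TopologicalSpace Bundle
open Literature.Geometry.Lorentzian
open scoped Manifold ContDiff Topology ENNReal

namespace Summit.FinalStateConjecture.FinalStateConjecture.Theorems.BondiBartnikRigidity.DirectMethod

namespace ChartGlue

open ChartData (lab_mem_pullK_iff deviation_eq_zero_of_exact)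
open F1Route (supCkENorm_zero_le_of_forall_eq_zero)

variable [Kerr.Facts] {𝒮 : Spacetime.{0} 4} {mo : lorentzGroup × E4} {M a : ℝ} {B : ModelBackground}

-- adapted from `Theorems/BartnikGapSettlingBondiBartnikRigidityMarchingLemmaChartGlue.lean` (`glue`)
omit [Kerr.Facts] in
/-- **Two exact charts agreeing on the overlap, with the cross-injectivity, glue to an exact chart** —
variant of `ChartGlue.glue` recording also that the glued chart is `Ψ₂` OFF `pullK Q₁` (needed for the
boundary clause of the marching invariant). [cite: DafermosRodnianski2008, §5.1] -/
theorem glue' (hB : B = starBackground mo.1 mo.2 M a (fun x => Kerr.radius a (poincareInv mo.1 mo.2 x)))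
    {Q₁ Q₂ : Set (Kerr.region a M)} (hQ₁ : IsOpen Q₁) (hQ₂ : IsOpen Q₂)
    {Ψ₁ Ψ₂ : B.domain → 𝒮.carrier}
    (hs₁ : ContMDiffOn 𝓘(ℝ, E4) (𝓡 4) ∞ Ψ₁ (pullK mo M a B Q₁))
    (he₁ : IsOpenEmbedding ((pullK mo M a B Q₁).restrict Ψ₁))
    (hd₁ : supCkENorm (Subtype.val '' pullK mo M a B Q₁) 0 (𝒮.deviationExtend B Ψ₁) ≤ 0)
    (htop₁ : ∀ x ∈ pullK mo M a B Q₁, 𝒮.timeOrientation.IsFutureDirected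
      (mfderiv 𝓘(ℝ, E4) (𝓡 4) Ψ₁ x ((mo.1 : E4 ≃L[ℝ] E4) (Kerr.timeVector M a (poincareInv mo.1 mo.2 x.1)))))
    (hs₂ : ContMDiffOn 𝓘(ℝ, E4) (𝓡 4) ∞ Ψ₂ (pullK mo M a B Q₂))
    (he₂ : IsOpenEmbedding ((pullK mo M a B Q₂).restrict Ψ₂))
    (hd₂ : supCkENorm (Subtype.val '' pullK mo M a B Q₂) 0 (𝒮.deviationExtend B Ψ₂) ≤ 0)
    (htop₂ : ∀ x ∈ pullK mo M a B Q₂, 𝒮.timeOrientation.IsFutureDirected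
      (mfderiv 𝓘(ℝ, E4) (𝓡 4) Ψ₂ x ((mo.1 : E4 ≃L[ℝ] E4) (Kerr.timeVector M a (poincareInv mo.1 mo.2 x.1)))))
    (hagree : ∀ x ∈ pullK mo M a B Q₁, x ∈ pullK mo M a B Q₂ → Ψ₁ x = Ψ₂ x)
    (hcross : ∀ x ∈ pullK mo M a B Q₁, ∀ x' ∈ pullK mo M a B Q₂, Ψ₁ x = Ψ₂ x' → x' ∈ pullK mo M a B Q₁) :
    ∃ Ψ : B.domain → 𝒮.carrier,
      ContMDiffOn 𝓘(ℝ, E4) (𝓡 4) ∞ Ψ (pullK mo M a B (Q₁ ∪ Q₂)) ∧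
      IsOpenEmbedding ((pullK mo M a B (Q₁ ∪ Q₂)).restrict Ψ) ∧
      supCkENorm (Subtype.val '' pullK mo M a B (Q₁ ∪ Q₂)) 0 (𝒮.deviationExtend B Ψ) ≤ 0 ∧
      (∀ x ∈ pullK mo M a B (Q₁ ∪ Q₂), 𝒮.timeOrientation.IsFutureDirected
        (mfderiv 𝓘(ℝ, E4) (𝓡 4) Ψ x ((mo.1 : E4 ≃L[ℝ] E4) (Kerr.timeVector M a (poincareInv mo.1 mo.2 x.1))))) ∧
      (∀ x ∈ pullK mo M a B Q₁, Ψ x = Ψ₁ x) ∧ (∀ x ∈ pullK mo M a B Q₂, Ψ x = Ψ₂ x) ∧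
      (∀ x, x ∉ pullK mo M a B Q₁ → Ψ x = Ψ₂ x) := by
  classical
  set P₁ := pullK mo M a B Q₁ with hP₁
  set P₂ := pullK mo M a B Q₂ with hP₂
  have hP₁o : IsOpen P₁ := K2Route.isOpen_pullK_of_eq hB hQ₁
  have hP₂o : IsOpen P₂ := K2Route.isOpen_pullK_of_eq hB hQ₂
  have hPU : pullK mo M a B (Q₁ ∪ Q₂) = P₁ ∪ P₂ := by
    ext x; constructor
    · rintro ⟨h, h₁ | h₂⟩
      · exact Or.inl ⟨h, h₁⟩
      · exact Or.inr ⟨h, h₂⟩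
    · rintro (⟨h, h₁⟩ | ⟨h, h₂⟩)
      · exact ⟨h, Or.inl h₁⟩
      · exact ⟨h, Or.inr h₂⟩
  let Ψ : B.domain → 𝒮.carrier := fun x => if x ∈ P₁ then Ψ₁ x else Ψ₂ x
  have hΨ₁ : ∀ x ∈ P₁, Ψ x = Ψ₁ x := fun x hx => if_pos hx
  have hΨ₂ : ∀ x ∈ P₂, Ψ x = Ψ₂ x := fun x hx => by
    by_cases h : x ∈ P₁
    · rw [hΨ₁ x h]; exact hagree x h hx
    · exact if_neg h
  -- `Ψ` is locally `Ψ₁` or `Ψ₂`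
  have hev₁ : ∀ x ∈ P₁, Ψ =ᶠ[𝓝 x] Ψ₁ := fun x hx => by
    filter_upwards [hP₁o.mem_nhds hx] with y hy; exact hΨ₁ y hy
  have hev₂ : ∀ x ∈ P₂, Ψ =ᶠ[𝓝 x] Ψ₂ := fun x hx => by
    filter_upwards [hP₂o.mem_nhds hx] with y hy; exact hΨ₂ y hy
  rw [hPU]
  refine ⟨Ψ, ?_, ?_, ?_, ?_, hΨ₁, hΨ₂, fun x hx => if_neg hx⟩
  · -- smooth
    rintro x (hx | hx)
    · exact (((hs₁ x hx).contMDiffAt (hP₁o.mem_nhds hx)).congr_of_eventuallyEq (hev₁ x hx)).contMDiffWithinAt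
    · exact (((hs₂ x hx).contMDiffAt (hP₂o.mem_nhds hx)).congr_of_eventuallyEq (hev₂ x hx)).contMDiffWithinAt
  · -- open embedding: continuous, injective, open
    refine IsOpenEmbedding.of_continuous_injective_isOpenMap ?_ ?_ ?_
    · refine continuousOn_iff_continuous_restrict.1 ?_
      rintro x (hx | hx)
      · exact (((hs₁ x hx).contMDiffAt (hP₁o.mem_nhds hx)).congr_of_eventuallyEq
          (hev₁ x hx)).continuousAt.continuousWithinAt
      · exact (((hs₂ x hx).contMDiffAt (hP₂o.mem_nhds hx)).congr_of_eventuallyEq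
          (hev₂ x hx)).continuousAt.continuousWithinAt
    · rintro ⟨x, hx⟩ ⟨y, hy⟩ hxy
      have hxy' : Ψ x = Ψ y := hxy
      have key : ∀ {x y}, x ∈ P₁ → y ∈ P₁ ∪ P₂ → Ψ x = Ψ y → x = y := by
        intro x y hx hy hxy
        have hyP₁ : y ∈ P₁ := by
          rcases hy with hy | hy
          · exact hy
          · rw [hΨ₁ x hx, hΨ₂ y hy] at hxy
            exact hcross x hx y hy hxy
        rw [hΨ₁ x hx, hΨ₁ y hyP₁] at hxy
        exact congrArg Subtype.val (he₁.injective (a₁ := ⟨x, hx⟩) (a₂ := ⟨y, hyP₁⟩) hxy)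
      have goal : x = y := by
        rcases hx with hx | hx
        · exact key hx hy hxy'
        · rcases hy with hy | hy
          · exact (key hy (Or.inr hx) hxy'.symm).symm
          · rw [hΨ₂ x hx, hΨ₂ y hy] at hxy'
            exact congrArg Subtype.val (he₂.injective (a₁ := ⟨x, hx⟩) (a₂ := ⟨y, hy⟩) hxy')
      exact Subtype.ext goal
    · -- open map: on the open cover by `P₁`, `P₂` it is `Ψ₁`, `Ψ₂`
      intro O hO
      have hOeq : (P₁ ∪ P₂).restrict Ψ '' O =
          (P₁.restrict Ψ₁ '' {x : P₁ | (⟨x.1, Or.inl x.2⟩ : ↥(P₁ ∪ P₂)) ∈ O}) ∪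
          (P₂.restrict Ψ₂ '' {x : P₂ | (⟨x.1, Or.inr x.2⟩ : ↥(P₁ ∪ P₂)) ∈ O}) := by
        ext q; constructor
        · rintro ⟨⟨x, hx⟩, hxO, rfl⟩
          rcases hx with hx | hx
          · exact Or.inl ⟨⟨x, hx⟩, hxO, (hΨ₁ x hx).symm⟩
          · exact Or.inr ⟨⟨x, hx⟩, hxO, (hΨ₂ x hx).symm⟩
        · rintro (⟨⟨x, hx⟩, hxO, rfl⟩ | ⟨⟨x, hx⟩, hxO, rfl⟩)
          · exact ⟨_, hxO, hΨ₁ x hx⟩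
          · exact ⟨_, hxO, hΨ₂ x hx⟩
      rw [hOeq]
      refine (he₁.isOpenMap _ ?_).union (he₂.isOpenMap _ ?_)
      · exact hO.preimage (Continuous.subtype_mk continuous_subtype_val _)
      · exact hO.preimage (Continuous.subtype_mk continuous_subtype_val _)
  · -- exactness
    refine supCkENorm_zero_le_of_forall_eq_zero ?_
    rintro _ ⟨x, hx, rfl⟩
    rw [Spacetime.deviationExtend_coe]
    rcases hx with hx | hx
    · rw [show 𝒮.deviation B Ψ x = 𝒮.deviation B Ψ₁ x by
        ext v w; rw [Spacetime.deviation_apply, Spacetime.deviation_apply, (hev₁ x hx).mfderiv_eq, hΨ₁ x hx]]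
      exact deviation_eq_zero_of_exact hd₁ hx
    · rw [show 𝒮.deviation B Ψ x = 𝒮.deviation B Ψ₂ x by
        ext v w; rw [Spacetime.deviation_apply, Spacetime.deviation_apply, (hev₂ x hx).mfderiv_eq, hΨ₂ x hx]]
      exact deviation_eq_zero_of_exact hd₂ hx
  · -- orientation
    rintro x (hx | hx)
    · rw [(hev₁ x hx).mfderiv_eq]
      have h := htop₁ x hx
      have hgen : ∀ q, q = Ψ₁ x → 𝒮.timeOrientation.IsFutureDirected (x := q)
          (mfderiv 𝓘(ℝ, E4) (𝓡 4) Ψ₁ x ((mo.1 : E4 ≃L[ℝ] E4) (Kerr.timeVector M a (poincareInv mo.1 mo.2 x.1)))) := by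
        rintro q rfl; exact h
      exact hgen _ (hΨ₁ x hx)
    · rw [(hev₂ x hx).mfderiv_eq]
      have h := htop₂ x hx
      have hgen : ∀ q, q = Ψ₂ x → 𝒮.timeOrientation.IsFutureDirected (x := q)
          (mfderiv 𝓘(ℝ, E4) (𝓡 4) Ψ₂ x ((mo.1 : E4 ≃L[ℝ] E4) (Kerr.timeVector M a (poincareInv mo.1 mo.2 x.1)))) := by
        rintro q rfl; exact h
      exact hgen _ (hΨ₂ x hx)


end ChartGlue

/-- **Registered bookkeeping sub-goal `stub_pullKInter` of the line** (brick of the landing of K2b-5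
`stub_marchingLemma`): the pull-back of an intersection is the intersection of the pull-backs (anchor of
this file, whose content is the gluing lemma with off-domain clause `ChartGlue.glue'`). [folklore] -/
theorem stub_pullKInter : ∀ (mo : lorentzGroup × E4) (M a : ℝ) (B : ModelBackground) (Q₁ Q₂ : Set (Kerr.region a M)),
    pullK mo M a B (Q₁ ∩ Q₂) = pullK mo M a B Q₁ ∩ pullK mo M a B Q₂ := by
  intro mo M a B Q₁ Q₂
  ext x; constructor
  · rintro ⟨h, hx⟩; exact ⟨⟨h, hx.1⟩, ⟨h, hx.2⟩⟩
  · rintro ⟨⟨h, hx₁⟩, ⟨_, hx₂⟩⟩; exact ⟨h, hx₁, hx₂⟩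

end Summit.FinalStateConjecture.FinalStateConjecture.Theorems.BondiBartnikRigidity.DirectMethod

end
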